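import Summits.RiemannHypothesis.RiemannHypothesis.Theses.ScrewFejerWindow
import HarnessLib

/-!
# `ScrewFejerWindow.Assembly` (item stmt-RiemannHypothesis-23969) — glue closer

`WindowLandau` is `WindowFloor → Summit.RiemannHypothesis` (the Fejér-window second-difference floor implies RH);
applying it to `WindowFloor` gives `Summit.RiemannHypothesis`: modus ponens.
Cell rh-split (typer-3 g3 glue sweep, RULING #379 (2b)).  Pure propositional glue; no analysis.
Nothing here bears on the truth of RH.
-/

set_option linter.dupNamespace false  -- the mandated namespace repeats `RiemannHypothesis`

namespace Summit.RiemannHypothesis.RiemannHypothesis.Theorems.ScrewFejerWindow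

/-- **`Assembly` (item stmt-RiemannHypothesis-23969) holds**: modus ponens. [folklore] -/
theorem assembly_proof : Summit.RiemannHypothesis.RiemannHypothesis.Theses.ScrewFejerWindow.Assembly :=
  fun h1 h2 => h1 h2

end Summit.RiemannHypothesis.RiemannHypothesis.Theorems.ScrewFejerWindow
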